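import Summits.CriticalPhenomena.PercolationContinuityZ3.Theorems.PercNearOneGluingNoHeavyLowerTailSahiOneStepSharedBitStep
import HarnessLib

/-!
# One shared coordinate: swap symmetry, the bit–bit base case, and the staircase theorem

Support file (prover prim-ineq-prove-3 gen 26; `--supports stmt-CriticalPhenomena-4575`; memo
`run/shared/lean/prim/prim-ineq-prove-3/FINDING-G26-ONE-SHARED-COORDINATE.md` §1).  No definitions, no sorries.

For the shared-bit three-chain collapse functional `N′` (see `…SharedBitKLevel`):
* `swap_eq` — exchanging the two private chains together with the two slots leaves `N′` unchanged;
* `bit_bit_nonneg` — both slots equal to the shared bit: `N′ ≥ 0` for ARBITRARY nonnegative private weights (the law of total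
  variance `Var Z ≥ P(L)·Var(Z | L)` in mass form);
* `stair_stair_nonneg` — two STAIRCASE slots, pairwise log-concave private weights: `N′ ≥ 0`, by `window_step` on the first slot,
  `swap_eq`, `window_step` on the second slot, `bit_bit_nonneg` (memo §1: Φ ≥ a(W)·b(W′)·[Var Z − P(L)Var(Z|L)] ≥ 0).
-/

namespace Summit.CriticalPhenomena.PercolationContinuityZ3.Theorems

namespace SahiOneStep

namespace ThreeChain

open Finset


/-- **Swap symmetry** of the collapse functional: exchanging the two private chains together with the two slots. [this work] -/
theorem swap_eq (K J t : ℕ) (c a b : ℕ → ℝ) (α β : ℕ → ℕ → ℝ) :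
    (∑ z ∈ range 2, ∑ k ∈ range (K + 1), ∑ j ∈ range (J + 1), if z + k + j < t then c z * a k * b j else 0) *
          (∑ z ∈ range 2, ∑ k ∈ range (K + 1), ∑ j ∈ range (J + 1), if z + k + j < t then 0 else c z * α z k * β z j)
        + (∑ z ∈ range 2, ∑ k ∈ range (K + 1), ∑ j ∈ range (J + 1), if z + k + j < t then c z * α z k * b j else 0) *
          (∑ z ∈ range 2, ∑ k ∈ range (K + 1), ∑ j ∈ range (J + 1), if z + k + j < t then c z * a k * β z j else 0)
        - (∑ z ∈ range 2, ∑ k ∈ range (K + 1), ∑ j ∈ range (J + 1), if z + k + j < t then c z * a k * b j else 0) *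
          (∑ z ∈ range 2, ∑ k ∈ range (K + 1), c z * α z k) * (∑ z ∈ range 2, ∑ j ∈ range (J + 1), c z * β z j) =
    (∑ z ∈ range 2, ∑ j ∈ range (J + 1), ∑ k ∈ range (K + 1), if z + j + k < t then c z * b j * a k else 0) *
          (∑ z ∈ range 2, ∑ j ∈ range (J + 1), ∑ k ∈ range (K + 1), if z + j + k < t then 0 else c z * β z j * α z k)
        + (∑ z ∈ range 2, ∑ j ∈ range (J + 1), ∑ k ∈ range (K + 1), if z + j + k < t then c z * β z j * a k else 0) *
          (∑ z ∈ range 2, ∑ j ∈ range (J + 1), ∑ k ∈ range (K + 1), if z + j + k < t then c z * b j * α z k else 0)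
        - (∑ z ∈ range 2, ∑ j ∈ range (J + 1), ∑ k ∈ range (K + 1), if z + j + k < t then c z * b j * a k else 0) *
          (∑ z ∈ range 2, ∑ j ∈ range (J + 1), c z * β z j) * (∑ z ∈ range 2, ∑ k ∈ range (K + 1), c z * α z k) := by
  have csw : ∀ (w : ℕ → ℕ → ℕ → ℝ), (∑ z ∈ range 2, ∑ k ∈ range (K + 1), ∑ j ∈ range (J + 1), w z k j) =
      ∑ z ∈ range 2, ∑ j ∈ range (J + 1), ∑ k ∈ range (K + 1), w z k j := fun w =>
    Finset.sum_congr rfl fun z _ => Finset.sum_comm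
  have e1 : (∑ z ∈ range 2, ∑ k ∈ range (K + 1), ∑ j ∈ range (J + 1), if z + k + j < t then c z * a k * b j else 0) =
      ∑ z ∈ range 2, ∑ j ∈ range (J + 1), ∑ k ∈ range (K + 1), if z + j + k < t then c z * b j * a k else 0 := by
    rw [csw]
    exact Finset.sum_congr rfl fun z _ => Finset.sum_congr rfl fun j _ => Finset.sum_congr rfl fun k _ => by
      rw [show z + j + k = z + k + j by ring]; split_ifs <;> ring
  have e2 : (∑ z ∈ range 2, ∑ k ∈ range (K + 1), ∑ j ∈ range (J + 1), if z + k + j < t then 0 else c z * α z k * β z j) =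
      ∑ z ∈ range 2, ∑ j ∈ range (J + 1), ∑ k ∈ range (K + 1), if z + j + k < t then 0 else c z * β z j * α z k := by
    rw [csw]
    exact Finset.sum_congr rfl fun z _ => Finset.sum_congr rfl fun j _ => Finset.sum_congr rfl fun k _ => by
      rw [show z + j + k = z + k + j by ring]; split_ifs <;> ring
  have e3 : (∑ z ∈ range 2, ∑ k ∈ range (K + 1), ∑ j ∈ range (J + 1), if z + k + j < t then c z * α z k * b j else 0) =
      ∑ z ∈ range 2, ∑ j ∈ range (J + 1), ∑ k ∈ range (K + 1), if z + j + k < t then c z * b j * α z k else 0 := by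
    rw [csw]
    exact Finset.sum_congr rfl fun z _ => Finset.sum_congr rfl fun j _ => Finset.sum_congr rfl fun k _ => by
      rw [show z + j + k = z + k + j by ring]; split_ifs <;> ring
  have e4 : (∑ z ∈ range 2, ∑ k ∈ range (K + 1), ∑ j ∈ range (J + 1), if z + k + j < t then c z * a k * β z j else 0) =
      ∑ z ∈ range 2, ∑ j ∈ range (J + 1), ∑ k ∈ range (K + 1), if z + j + k < t then c z * β z j * a k else 0 := by
    rw [csw]
    exact Finset.sum_congr rfl fun z _ => Finset.sum_congr rfl fun j _ => Finset.sum_congr rfl fun k _ => by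
      rw [show z + j + k = z + k + j by ring]; split_ifs <;> ring
  rw [e1, e2, e3, e4]; ring

/-- **The base case: both slots are the shared bit.**  For arbitrary nonnegative private weights the collapse functional of the pair
(bit, bit) is nonnegative — the law of total variance `Var Z ≥ P(L)·Var(Z | L)` in mass form. [this work] -/
theorem bit_bit_nonneg (K J t : ℕ) (c a b : ℕ → ℝ) (hc : ∀ z, 0 ≤ c z) (hc1 : c 0 + c 1 = 1)
    (ha : ∀ k, 0 ≤ a k) (hb : ∀ j, 0 ≤ b j) :
    0 ≤ (∑ z ∈ range 2, ∑ k ∈ range (K + 1), ∑ j ∈ range (J + 1), if z + k + j < t then c z * a k * b j else 0) *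
          (∑ z ∈ range 2, ∑ k ∈ range (K + 1), ∑ j ∈ range (J + 1),
            if z + k + j < t then 0 else c z * (if z = 1 then a k else 0) * (if z = 1 then b j else 0))
        + (∑ z ∈ range 2, ∑ k ∈ range (K + 1), ∑ j ∈ range (J + 1),
            if z + k + j < t then c z * (if z = 1 then a k else 0) * b j else 0) *
          (∑ z ∈ range 2, ∑ k ∈ range (K + 1), ∑ j ∈ range (J + 1),
            if z + k + j < t then c z * a k * (if z = 1 then b j else 0) else 0)
        - (∑ z ∈ range 2, ∑ k ∈ range (K + 1), ∑ j ∈ range (J + 1), if z + k + j < t then c z * a k * b j else 0) *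
          (∑ z ∈ range 2, ∑ k ∈ range (K + 1), c z * (if z = 1 then a k else 0)) *
          (∑ z ∈ range 2, ∑ j ∈ range (J + 1), c z * (if z = 1 then b j else 0)) := by
  -- the two ball masses and the total mass
  set l0 : ℝ := ∑ k ∈ range (K + 1), ∑ j ∈ range (J + 1), if 0 + k + j < t then a k * b j else 0 with hl0
  set l1 : ℝ := ∑ k ∈ range (K + 1), ∑ j ∈ range (J + 1), if 1 + k + j < t then a k * b j else 0 with hl1
  set A : ℝ := ∑ k ∈ range (K + 1), a k with hA
  set B : ℝ := ∑ j ∈ range (J + 1), b j with hB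
  have hAB : (∑ k ∈ range (K + 1), ∑ j ∈ range (J + 1), a k * b j) = A * B := by
    rw [Finset.sum_mul_sum]
  have hl0n : 0 ≤ l0 := Finset.sum_nonneg fun k _ => Finset.sum_nonneg fun j _ => by
    split_ifs; exacts [mul_nonneg (ha k) (hb j), le_rfl]
  have hl1n : 0 ≤ l1 := Finset.sum_nonneg fun k _ => Finset.sum_nonneg fun j _ => by
    split_ifs; exacts [mul_nonneg (ha k) (hb j), le_rfl]
  have hl0le : l0 ≤ A * B := by
    rw [← hAB]
    exact Finset.sum_le_sum fun k _ => Finset.sum_le_sum fun j _ => by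
      split_ifs; exacts [le_rfl, mul_nonneg (ha k) (hb j)]
  have hl1le : l1 ≤ A * B := by
    rw [← hAB]
    exact Finset.sum_le_sum fun k _ => Finset.sum_le_sum fun j _ => by
      split_ifs; exacts [le_rfl, mul_nonneg (ha k) (hb j)]
  -- evaluate the six sums
  have zne : ((0:ℕ) = 1) = False := by simp
  have e1 : (∑ z ∈ range 2, ∑ k ∈ range (K + 1), ∑ j ∈ range (J + 1), if z + k + j < t then c z * a k * b j else 0) =
      c 0 * l0 + c 1 * l1 := by
    rw [sum_range_two]; simp only [hl0, hl1]; rw [Finset.mul_sum, Finset.mul_sum]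
    congr 1 <;> refine Finset.sum_congr rfl fun k _ => ?_ <;> rw [Finset.mul_sum] <;>
      exact Finset.sum_congr rfl fun j _ => by split_ifs <;> ring
  have e2 : (∑ z ∈ range 2, ∑ k ∈ range (K + 1), ∑ j ∈ range (J + 1),
      if z + k + j < t then 0 else c z * (if z = 1 then a k else 0) * (if z = 1 then b j else 0)) = c 1 * (A * B - l1) := by
    rw [sum_range_two]; simp only [zne, if_false, if_true]
    have h0 : (∑ k ∈ range (K + 1), ∑ j ∈ range (J + 1), if 0 + k + j < t then (0:ℝ) else c 0 * 0 * 0) = 0 :=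
      Finset.sum_eq_zero fun k _ => Finset.sum_eq_zero fun j _ => by split_ifs <;> ring
    rw [h0, zero_add, ← hAB, mul_sub, Finset.mul_sum, hl1, Finset.mul_sum, ← Finset.sum_sub_distrib]
    refine Finset.sum_congr rfl fun k _ => ?_
    rw [Finset.mul_sum, Finset.mul_sum, ← Finset.sum_sub_distrib]
    exact Finset.sum_congr rfl fun j _ => by split_ifs <;> ring
  have e3 : (∑ z ∈ range 2, ∑ k ∈ range (K + 1), ∑ j ∈ range (J + 1),
      if z + k + j < t then c z * (if z = 1 then a k else 0) * b j else 0) = c 1 * l1 := by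
    rw [sum_range_two]; simp only [zne, if_false, if_true]
    have h0 : (∑ k ∈ range (K + 1), ∑ j ∈ range (J + 1), if 0 + k + j < t then c 0 * 0 * b j else (0:ℝ)) = 0 :=
      Finset.sum_eq_zero fun k _ => Finset.sum_eq_zero fun j _ => by split_ifs <;> ring
    rw [h0, zero_add, hl1, Finset.mul_sum]
    refine Finset.sum_congr rfl fun k _ => ?_
    rw [Finset.mul_sum]
    exact Finset.sum_congr rfl fun j _ => by split_ifs <;> ring
  have e4 : (∑ z ∈ range 2, ∑ k ∈ range (K + 1), ∑ j ∈ range (J + 1),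
      if z + k + j < t then c z * a k * (if z = 1 then b j else 0) else 0) = c 1 * l1 := by
    rw [sum_range_two]; simp only [zne, if_false, if_true]
    have h0 : (∑ k ∈ range (K + 1), ∑ j ∈ range (J + 1), if 0 + k + j < t then c 0 * a k * 0 else (0:ℝ)) = 0 :=
      Finset.sum_eq_zero fun k _ => Finset.sum_eq_zero fun j _ => by split_ifs <;> ring
    rw [h0, zero_add, hl1, Finset.mul_sum]
    refine Finset.sum_congr rfl fun k _ => ?_
    rw [Finset.mul_sum]
    exact Finset.sum_congr rfl fun j _ => by split_ifs <;> ring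
  have e5 : (∑ z ∈ range 2, ∑ k ∈ range (K + 1), c z * (if z = 1 then a k else 0)) = c 1 * A := by
    rw [sum_range_two]; simp only [zne, if_false, if_true]
    rw [hA, Finset.mul_sum]; simp
  have e6 : (∑ z ∈ range 2, ∑ j ∈ range (J + 1), c z * (if z = 1 then b j else 0)) = c 1 * B := by
    rw [sum_range_two]; simp only [zne, if_false, if_true]
    rw [hB, Finset.mul_sum]; simp
  rw [e1, e2, e3, e4, e5, e6]
  have hc0 : c 0 = 1 - c 1 := by linarith
  have key : (c 0 * l0 + c 1 * l1) * (c 1 * (A * B - l1)) + c 1 * l1 * (c 1 * l1) -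
      (c 0 * l0 + c 1 * l1) * (c 1 * A) * (c 1 * B) = c 0 * c 1 * (c 0 * l0 * (A * B - l1) + c 1 * l1 * (A * B - l0)) := by
    rw [hc0]; ring
  rw [key]
  have h1 : 0 ≤ c 0 * l0 * (A * B - l1) := mul_nonneg (mul_nonneg (hc 0) hl0n) (sub_nonneg.2 hl1le)
  have h2 : 0 ≤ c 1 * l1 * (A * B - l0) := mul_nonneg (mul_nonneg (hc 1) hl1n) (sub_nonneg.2 hl0le)
  exact mul_nonneg (mul_nonneg (hc 0) (hc 1)) (add_nonneg h1 h2)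


/-- **Staircase theorem.**  For nonnegative pairwise log-concave private weights `a, b` (supported in `{0..K}`, `{0..J}`), bit weights
`c 0 + c 1 = 1`, and two STAIRCASE slots `α z k = a k·[θ z ≤ k]`, `β z j = b j·[φ z ≤ j]` (`θ 1 ≤ θ 0`, `φ 1 ≤ φ 0`), the collapse
functional is nonnegative.  Proof: `window_step` on the first slot, `swap_eq`, `window_step` on the second slot, and `bit_bit_nonneg`
(memo §1: Φ ≥ a(W)·b(W′)·[Var Z − P(L)Var(Z|L)] ≥ 0). [this work] -/
theorem stair_stair_nonneg (K J t : ℕ) (c a b : ℕ → ℝ) (θ φ : ℕ → ℕ)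
    (hc : ∀ z, 0 ≤ c z) (hc1 : c 0 + c 1 = 1)
    (ha : ∀ k, 0 ≤ a k) (haK : ∀ k, K < k → a k = 0) (halc : ∀ i j, i < j → a i * a (j + 1) ≤ a (i + 1) * a j)
    (hb : ∀ j, 0 ≤ b j) (hbJ : ∀ j, J < j → b j = 0) (hblc : ∀ i j, i < j → b i * b (j + 1) ≤ b (i + 1) * b j)
    (hθ : θ 1 ≤ θ 0) (hφ : φ 1 ≤ φ 0) :
    0 ≤ (∑ z ∈ range 2, ∑ k ∈ range (K + 1), ∑ j ∈ range (J + 1), if z + k + j < t then c z * a k * b j else 0) *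
          (∑ z ∈ range 2, ∑ k ∈ range (K + 1), ∑ j ∈ range (J + 1),
            if z + k + j < t then 0 else c z * (if θ z ≤ k then a k else 0) * (if φ z ≤ j then b j else 0))
        + (∑ z ∈ range 2, ∑ k ∈ range (K + 1), ∑ j ∈ range (J + 1),
            if z + k + j < t then c z * (if θ z ≤ k then a k else 0) * b j else 0) *
          (∑ z ∈ range 2, ∑ k ∈ range (K + 1), ∑ j ∈ range (J + 1),
            if z + k + j < t then c z * a k * (if φ z ≤ j then b j else 0) else 0)
        - (∑ z ∈ range 2, ∑ k ∈ range (K + 1), ∑ j ∈ range (J + 1), if z + k + j < t then c z * a k * b j else 0) *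
          (∑ z ∈ range 2, ∑ k ∈ range (K + 1), c z * (if θ z ≤ k then a k else 0)) *
          (∑ z ∈ range 2, ∑ j ∈ range (J + 1), c z * (if φ z ≤ j then b j else 0)) := by
  -- hypotheses of `window_step` for the staircase second slot
  have hβ0 : ∀ z j, 0 ≤ (if φ z ≤ j then b j else 0) := fun z j => by split_ifs; exacts [hb j, le_rfl]
  have hβb : ∀ z j, (if φ z ≤ j then b j else 0) ≤ b j := fun z j => by split_ifs; exacts [le_rfl, hb j]
  have hβz : ∀ j, (if φ 0 ≤ j then b j else 0) ≤ (if φ 1 ≤ j then b j else 0) := fun j => by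
    by_cases h : φ 0 ≤ j
    · rw [if_pos h, if_pos (hφ.trans h)]
    · rw [if_neg h]; split_ifs; exacts [hb j, le_rfl]
  have hβj : ∀ z j j', j ≤ j' → (if φ z ≤ j then b j else 0) * b j' ≤ (if φ z ≤ j' then b j' else 0) * b j := by
    intro z j j' hjj'
    by_cases h : φ z ≤ j
    · rw [if_pos h, if_pos (h.trans hjj'), mul_comm]
    · rw [if_neg h, zero_mul]; exact mul_nonneg (hβ0 z j') (hb j)
  refine window_step K J t c a b θ (fun z j => if φ z ≤ j then b j else 0) hc hc1 ha hb hbJ hblc hβ0 hβb hβz hβj hθ ?_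
  -- the restricted instance, first slot = the bit; swap the two chains
  have hsw := swap_eq K J t c (fun k => if θ 1 ≤ k ∧ k < θ 0 then a k else 0) b
    (fun z k => if z = 1 then (if θ 1 ≤ k ∧ k < θ 0 then a k else 0) else 0) (fun z j => if φ z ≤ j then b j else 0)
  rw [hsw]
  -- data of the window-restricted first chain
  have haW0 : ∀ k, 0 ≤ (if θ 1 ≤ k ∧ k < θ 0 then a k else 0) := fun k => by split_ifs; exacts [ha k, le_rfl]
  have haWK : ∀ k, K < k → (if θ 1 ≤ k ∧ k < θ 0 then a k else 0) = 0 := fun k hk => by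
    split_ifs; exacts [haK k hk, rfl]
  have haWlc := logConcave_restrict a ha halc (θ 0) (θ 1)
  have hζ0 : ∀ z k, 0 ≤ (if z = 1 then (if θ 1 ≤ k ∧ k < θ 0 then a k else 0) else 0) := fun z k => by
    split_ifs <;> first | exact le_rfl | exact ha k
  have hζa : ∀ z k, (if z = 1 then (if θ 1 ≤ k ∧ k < θ 0 then a k else 0) else 0) ≤
      (if θ 1 ≤ k ∧ k < θ 0 then a k else 0) := fun z k => by
    split_ifs <;> first | exact le_rfl | exact ha k
  have hζz : ∀ k, (if (0:ℕ) = 1 then (if θ 1 ≤ k ∧ k < θ 0 then a k else 0) else 0) ≤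
      (if (1:ℕ) = 1 then (if θ 1 ≤ k ∧ k < θ 0 then a k else 0) else 0) := fun k => by
    simp only [show ((0:ℕ) = 1) = False from by simp, if_false, if_true]; exact haW0 k
  have hζk : ∀ z k k', k ≤ k' → (if z = 1 then (if θ 1 ≤ k ∧ k < θ 0 then a k else 0) else 0) *
      (if θ 1 ≤ k' ∧ k' < θ 0 then a k' else 0) ≤
      (if z = 1 then (if θ 1 ≤ k' ∧ k' < θ 0 then a k' else 0) else 0) * (if θ 1 ≤ k ∧ k < θ 0 then a k else 0) := by
    intro z k k' _
    by_cases hz : z = 1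
    · rw [if_pos hz, if_pos hz, mul_comm]
    · rw [if_neg hz, if_neg hz, zero_mul, zero_mul]
  refine window_step J K t c b (fun k => if θ 1 ≤ k ∧ k < θ 0 then a k else 0) φ
    (fun z k => if z = 1 then (if θ 1 ≤ k ∧ k < θ 0 then a k else 0) else 0)
    hc hc1 hb haW0 haWK haWlc hζ0 hζa hζz hζk hφ ?_
  -- both slots are the bit: total variance
  exact bit_bit_nonneg J K t c (fun j => if φ 1 ≤ j ∧ j < φ 0 then b j else 0)
    (fun k => if θ 1 ≤ k ∧ k < θ 0 then a k else 0) hc hc1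
    (fun j => by split_ifs; exacts [hb j, le_rfl]) haW0



end ThreeChain

end SahiOneStep

end Summit.CriticalPhenomena.PercolationContinuityZ3.Theorems
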